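import Summits.ValiantsHypothesis.ValiantsHypothesis.Theorems.SymPencilPerFourHessianColControl

/-!
# Route `SymPencil` — Hessian rank `≤ 5` on a subspace: a rank-`3` row with a proportional pair
# of cells (Case B2 of Task T1 of `Cruxes/SdcSuperquadratic/NEXT-RUNG-23.md`;
# `--supports` stmt-ValiantsHypothesis-5674 `SdcSuperquadratic`)

Setting: `W` a subspace of `4 × 4` matrices with the swapped property with `< 6` squares
(`rank (Hess per_4) ≤ 5` on `W`), so that every (row pair, column) has a partner column with
identically vanishing `2 × 2` subpermanent (`SymPencilPerFourHessianMinors`), and the control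
lemma of `SymPencilPerFourHessianRowControl` applies.

**Case B2** (`finrank_le_six_of_prop_pair`).  Suppose that in row `a` the cells of two columns
`m₁ ≠ m₂` are proportional on `W`, `x_{a m₁} ≡ μ x_{a m₂}` with `μ ≠ 0`, while row `a` realises
every vector `v` with `v_{m₁} = μ v_{m₂}` (so row `a` has rank `3`).  Then `dim W ≤ 6`.

Proof.  Let `W₀ = {x ∈ W : row a = 0}`; `dim W ≤ 3 + dim W₀` by rank–nullity and
`ρ_a(W) ⊆ {v_{m₁} = μ v_{m₂}}`.  For a row `b ≠ a`:
the partner of a column `m ∉ {m₁, m₂}` gives, by control (both cells of row `a` free on the pair),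
`x_{bm} = 0` on `W₀`; the partner `c` of `m₁` is either `m₂` — then
`x_{a m₂}(x_{b m₁} + μ x_{b m₂}) ≡ 0`, so `x_{b m₁} ≡ -μ x_{b m₂}` on `W` — or `∉ {m₁, m₂}`, and then
control gives `x_{b m₁} = 0` on `W₀`; symmetrically for `m₂`.  In every case row `b` of an element
of `W₀` is determined by its entry `x_{b m₂}`, so `x ↦ (x_{b m₂})_{b ≠ a}` embeds `W₀` into `K³`:
`dim W₀ ≤ 3`, `dim W ≤ 6`.

Honest framing: a lemma towards `sdc(per_4) ≥ 25`; nothing here changes `sdc(per_4) ≥ 23`; the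
crux stays open; `VP ≠ VNP` is not moved. [folklore]
-/

noncomputable section

-- single-conjunct layout: Sub = Summit, duplicated namespace component intended
set_option linter.dupNamespace false

namespace Summit.ValiantsHypothesis.ValiantsHypothesis.Theorems.SymPencilPerFourHessianRankThreeProp

open Matrix MvPolynomial Finset Module
open Literature.Computability.AlgebraicComplexity
open Summit.ValiantsHypothesis.ValiantsHypothesis.Theorems.SymPencilPerFourHessianMinors
open Summit.ValiantsHypothesis.ValiantsHypothesis.Theorems.SymPencilPerFourHessianRowControl
open Literature.Computability.AlgebraicComplexity.AlperBogartVelasco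

variable {K : Type*} [Field K]

/-- A linear functional (a cell) is polynomial along lines. [folklore] -/
theorem linePoly_cell (p : Fin 4 × Fin 4) (y₀ y : Fin 4 × Fin 4 → K) :
    ∃ q : Polynomial K, ∀ t : K, (fun z : Fin 4 × Fin 4 → K => z p) (y₀ + t • y) = q.eval t := by
  refine ⟨Polynomial.C (y₀ p) + Polynomial.C (y p) * Polynomial.X, fun t => ?_⟩
  simp only [Pi.add_apply, Pi.smul_apply, smul_eq_mul, Polynomial.eval_add, Polynomial.eval_mul,
    Polynomial.eval_C, Polynomial.eval_X]
  ring

/-- An affine combination of two cells is polynomial along lines. [folklore] -/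
theorem linePoly_cell_add_mul (p p' : Fin 4 × Fin 4) (μ : K) (y₀ y : Fin 4 × Fin 4 → K) :
    ∃ q : Polynomial K, ∀ t : K,
      (fun z : Fin 4 × Fin 4 → K => z p + μ * z p') (y₀ + t • y) = q.eval t := by
  refine ⟨Polynomial.C (y₀ p + μ * y₀ p') + Polynomial.C (y p + μ * y p') * Polynomial.X,
    fun t => ?_⟩
  simp only [Pi.add_apply, Pi.smul_apply, smul_eq_mul, Polynomial.eval_add, Polynomial.eval_mul,
    Polynomial.eval_C, Polynomial.eval_X]
  ring

/-- If a product of two functions, each polynomial along lines, vanishes on a subspace `W`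
(infinite field), then one factor vanishes identically on `W`. [folklore] -/
theorem forall_eq_zero_or_of_mul₂ [Infinite K] {M : Type*} [AddCommGroup M] [Module K M]
    (W : Submodule K M) {f g : M → K}
    (hf : ∀ y₀ y : M, ∃ p : Polynomial K, ∀ t : K, f (y₀ + t • y) = p.eval t)
    (hg : ∀ y₀ y : M, ∃ p : Polynomial K, ∀ t : K, g (y₀ + t • y) = p.eval t)
    (H : ∀ y ∈ W, f y * g y = 0) :
    (∀ y ∈ W, f y = 0) ∨ (∀ y ∈ W, g y = 0) := by
  by_contra hne
  push Not at hne
  obtain ⟨⟨y₁, hy₁, hf₁⟩, ⟨y₂, hy₂, hg₂⟩⟩ := hne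
  obtain ⟨y, hy, hf', hg'⟩ := exists_ne_zero_and_ne_zero W hf hg hy₁ hy₂ hf₁ hg₂
  exact mul_ne_zero hf' hg' (H y hy)

/-- **Case B2: a rank-`3` row with a proportional pair of cells forces `dim W ≤ 6`.**  See the
module docstring. [folklore] -/
theorem finrank_le_six_of_prop_pair [CharZero K] {ι : Type*} [Fintype ι]
    (hι : Fintype.card ι < 6) (W : Submodule K (Fin 4 × Fin 4 → K))
    (hW : ∀ y ∈ W, ∃ (c : ι → K) (Λ : ι → ((Fin 4 × Fin 4 → K) →ₗ[K] K)),
      ∀ u : Fin 4 × Fin 4 → K, ∃ e₀ e₁ : K, ∀ s : K,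
        eval (u + s • y) (perPoly (Fin 4) K) = e₀ + s * e₁ + s ^ 2 * ∑ k, c k * (Λ k u) ^ 2)
    (a m₁ m₂ : Fin 4) (hm : m₁ ≠ m₂) (μ : K) (hμ : μ ≠ 0)
    (hprop : ∀ x ∈ W, x (a, m₁) = μ * x (a, m₂))
    (hreal : ∀ v : Fin 4 → K, v m₁ = μ * v m₂ → ∃ z ∈ W, ∀ j, z (a, j) = v j) :
    finrank K W ≤ 6 := by
  classical
  -- row `a` as a linear map, and `W₀ = W ∩ ker ρ`
  let ρ : (Fin 4 × Fin 4 → K) →ₗ[K] (Fin 4 → K) := LinearMap.funLeft K K fun j : Fin 4 => (a, j)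
  have hρ : ∀ x j, ρ x j = x (a, j) := fun _ _ => rfl
  -- (1) the image of row `a` lies in the hyperplane `v_{m₁} = μ v_{m₂}`: rank `≤ 3`
  let φ : (Fin 4 → K) →ₗ[K] K :=
    { toFun := fun v => v m₁ - μ * v m₂
      map_add' := fun v w => by simp only [Pi.add_apply]; ring
      map_smul' := fun c v => by simp only [Pi.smul_apply, smul_eq_mul, RingHom.id_apply]; ring }
  have hφ : ∀ v, φ v = v m₁ - μ * v m₂ := fun v => rfl
  have hφne : φ ≠ 0 := by
    intro h
    have := LinearMap.congr_fun h (Pi.single m₁ 1)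
    rw [hφ, LinearMap.zero_apply, Pi.single_eq_same, Pi.single_eq_of_ne hm.symm, mul_zero,
      sub_zero] at this
    exact one_ne_zero this
  have hrange : W.map ρ ≤ LinearMap.ker φ := by
    rintro _ ⟨x, hx, rfl⟩
    rw [LinearMap.mem_ker, hφ, hρ, hρ, hprop x hx, sub_self]
  have hker3 : finrank K (LinearMap.ker φ) = 3 := by
    have h1 : finrank K (LinearMap.range φ) = 1 := by
      have hle : finrank K (LinearMap.range φ) ≤ 1 := by
        have := Submodule.finrank_le (LinearMap.range φ)
        rwa [Module.finrank_self] at this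
      have hpos : 0 < finrank K (LinearMap.range φ) := by
        rw [Module.finrank_pos_iff_exists_ne_zero]
        obtain ⟨v, hv⟩ : ∃ v, φ v ≠ 0 := by
          by_contra h
          push Not at h
          exact hφne (LinearMap.ext h)
        exact ⟨⟨φ v, v, rfl⟩, fun h => hv (Subtype.ext_iff.1 h)⟩
      omega
    have h := LinearMap.finrank_range_add_finrank_ker φ
    rw [Module.finrank_fintype_fun_eq_card, Fintype.card_fin] at h
    omega
  have hrank : finrank K (W.map ρ) ≤ 3 := by
    have := Submodule.finrank_mono hrange
    omega
  -- (2) realisability of row `a` on pairs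
  have hgen : ∀ m c : Fin 4, m ≠ c → ¬(m = m₁ ∧ c = m₂) → ¬(m = m₂ ∧ c = m₁) →
      ∃ z ∈ W, z (a, m) = 1 ∧ z (a, c) = 0 := by
    intro m c hmc h12 h21
    -- choose `v` with `v m = 1`, `v c = 0`, `v m₁ = μ v m₂`
    by_cases hm1 : m = m₁
    · -- then `c ≠ m₂`; take `v = e_{m₁} + μ⁻¹ e_{m₂}`
      subst hm1
      have hc2 : c ≠ m₂ := fun h => h12 ⟨rfl, h⟩
      obtain ⟨z, hz, hzv⟩ := hreal (Pi.single m 1 + μ⁻¹ • Pi.single m₂ 1) (by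
        simp only [Pi.add_apply, Pi.smul_apply, smul_eq_mul, Pi.single_eq_same,
          Pi.single_eq_of_ne hm, Pi.single_eq_of_ne hm.symm, mul_zero, add_zero, zero_add,
          mul_one, mul_inv_cancel₀ hμ])
      refine ⟨z, hz, ?_, ?_⟩
      · rw [hzv]; simp [Pi.single_eq_of_ne hm]
      · rw [hzv]; simp [Pi.single_eq_of_ne hmc.symm, Pi.single_eq_of_ne hc2]
    by_cases hm2 : m = m₂
    · subst hm2
      have hc1 : c ≠ m₁ := fun h => h21 ⟨rfl, h⟩
      obtain ⟨z, hz, hzv⟩ := hreal (Pi.single m 1 + μ • Pi.single m₁ 1) (by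
        simp only [Pi.add_apply, Pi.smul_apply, smul_eq_mul, Pi.single_eq_same,
          Pi.single_eq_of_ne hm, Pi.single_eq_of_ne hm.symm]
        ring)
      refine ⟨z, hz, ?_, ?_⟩
      · rw [hzv]; simp [Pi.single_eq_of_ne hm.symm]
      · rw [hzv]; simp [Pi.single_eq_of_ne hmc.symm, Pi.single_eq_of_ne hc1]
    · -- `m ∉ {m₁, m₂}`: take `v = e_m` (then `v m₁ = 0 = μ v m₂`)
      obtain ⟨z, hz, hzv⟩ := hreal (Pi.single m 1) (by
        rw [Pi.single_eq_of_ne (Ne.symm hm1), Pi.single_eq_of_ne (Ne.symm hm2), mul_zero])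
      exact ⟨z, hz, by rw [hzv, Pi.single_eq_same], by rw [hzv, Pi.single_eq_of_ne hmc.symm]⟩
  have hx2 : ¬ ∀ x ∈ W, x (a, m₂) = 0 := by
    intro h
    obtain ⟨z, hz, hzv⟩ := hreal (Pi.single m₁ 1 + μ⁻¹ • Pi.single m₂ 1) (by
      simp only [Pi.add_apply, Pi.smul_apply, smul_eq_mul, Pi.single_eq_same,
        Pi.single_eq_of_ne hm, Pi.single_eq_of_ne hm.symm, mul_zero, add_zero, zero_add,
        mul_one, mul_inv_cancel₀ hμ])
    have := h z hz
    rw [hzv] at this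
    simp [Pi.single_eq_of_ne hm.symm, hμ] at this
  -- (3) each row `b ≠ a` of an element of `W₀` is a multiple of a fixed vector, read off at `m₂`
  have hrow : ∀ b, b ≠ a → ∀ x ∈ W, (∀ j, x (a, j) = 0) → x (b, m₂) = 0 → ∀ j, x (b, j) = 0 := by
    intro b hba x hx hxa hxb2
    -- columns outside `{m₁, m₂}` vanish on `W₀`
    have hout : ∀ m, m ≠ m₁ → m ≠ m₂ → x (b, m) = 0 := by
      intro m h1 h2
      obtain ⟨c, hcm, hq⟩ := exists_perm_col_vanish_of_sum_sq_swap hι W hW a b m hba.symm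
      have h10 := hgen m c hcm.symm (fun h => h1 h.1) (fun h => h2 h.1)
      have h01 : ∃ z ∈ W, z (a, m) = 0 ∧ z (a, c) = 1 := by
        obtain ⟨z, hz, h1', h0'⟩ := hgen c m hcm (fun h => h2 h.2) (fun h => h1 h.2)
        exact ⟨z, hz, h0', h1'⟩
      exact (cell_eq_zero_of_perm_vanish W hq h10 h01 hx (hxa m) (hxa c)).1
    -- the partner of `m₁`
    have hm1 : x (b, m₁) = 0 := by
      obtain ⟨c, hcm, hq⟩ := exists_perm_col_vanish_of_sum_sq_swap hι W hW a b m₁ hba.symm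
      by_cases hc2 : c = m₂
      · subst hc2
        -- `x_{a m₂} (x_{b m₁} + μ x_{b m₂}) ≡ 0` on `W`, and `x_{a m₂} ≢ 0`
        have hprod : ∀ y ∈ W, y (a, c) * (y (b, m₁) + μ * y (b, c)) = 0 := by
          intro y hy
          have h := hq y hy
          rw [hprop y hy] at h
          linear_combination h
        rcases forall_eq_zero_or_of_mul₂ W (linePoly_cell (a, c)) (linePoly_cell_add_mul (b, m₁) (b, c) μ)
          hprod with h | h
        · exact absurd h hx2
        · have := h x hx
          rw [hxb2, mul_zero, add_zero] at this
          exact this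
      · have h10 := hgen m₁ c hcm.symm (fun h => hc2 h.2) (fun h => hm h.1)
        have h01 : ∃ z ∈ W, z (a, m₁) = 0 ∧ z (a, c) = 1 := by
          obtain ⟨z, hz, h1', h0'⟩ := hgen c m₁ hcm (fun h => hcm h.1 |>.elim)
            (fun h => hc2 h.1)
          exact ⟨z, hz, h0', h1'⟩
        exact (cell_eq_zero_of_perm_vanish W hq h10 h01 hx (hxa m₁) (hxa c)).1
    intro j
    by_cases hj1 : j = m₁
    · rw [hj1]; exact hm1
    by_cases hj2 : j = m₂
    · rw [hj2]; exact hxb2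
    exact hout j hj1 hj2
  -- (4) `W₀ = W ∩ {row a = 0}`; `x ↦ (x_{b m₂})_b` is injective on `W₀` with image in `{v_a = 0}`
  set W₀ : Submodule K (Fin 4 × Fin 4 → K) := W ⊓ LinearMap.ker ρ with hW₀
  have memW₀ : ∀ x, x ∈ W₀ ↔ x ∈ W ∧ ∀ j, x (a, j) = 0 := fun x => by
    rw [hW₀, Submodule.mem_inf, LinearMap.mem_ker]
    exact ⟨fun h => ⟨h.1, fun j => by have := congr_fun h.2 j; rwa [hρ] at this⟩,
      fun h => ⟨h.1, funext fun j => h.2 j⟩⟩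
  let γ : (Fin 4 × Fin 4 → K) →ₗ[K] (Fin 4 → K) := LinearMap.funLeft K K fun b : Fin 4 => (b, m₂)
  have hγ : ∀ x b, γ x b = x (b, m₂) := fun _ _ => rfl
  have hker : LinearMap.ker (γ.domRestrict W₀) = ⊥ := by
    rw [Submodule.eq_bot_iff]
    intro x hx
    rw [LinearMap.mem_ker, LinearMap.domRestrict_apply] at hx
    obtain ⟨hxW, hxa⟩ := (memW₀ x).1 x.2
    apply Subtype.ext
    funext p
    obtain ⟨b, j⟩ := p
    change (x : Fin 4 × Fin 4 → K) (b, j) = 0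
    by_cases hba : b = a
    · rw [hba]; exact hxa j
    · exact hrow b hba x hxW hxa (by have := congr_fun hx b; rwa [hγ] at this) j
  have h1 : finrank K (LinearMap.range (γ.domRestrict W₀)) = finrank K W₀ := by
    have := LinearMap.finrank_range_add_finrank_ker (γ.domRestrict W₀)
    rw [hker, finrank_bot, add_zero] at this
    exact this
  have hle : LinearMap.range (γ.domRestrict W₀) ≤
      LinearMap.ker (LinearMap.proj a : (Fin 4 → K) →ₗ[K] K) := by
    rintro _ ⟨x, rfl⟩
    rw [LinearMap.mem_ker, LinearMap.proj_apply, LinearMap.domRestrict_apply, hγ]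
    exact ((memW₀ x).1 x.2).2 m₂
  have hk : finrank K (LinearMap.ker (LinearMap.proj a : (Fin 4 → K) →ₗ[K] K)) = 3 := by
    have hsurj : Function.Surjective (LinearMap.proj a : (Fin 4 → K) →ₗ[K] K) :=
      fun t => ⟨Pi.single a t, by simp⟩
    have h := LinearMap.finrank_range_add_finrank_ker (LinearMap.proj a : (Fin 4 → K) →ₗ[K] K)
    rw [LinearMap.range_eq_top.2 hsurj, finrank_top, Module.finrank_self,
      Module.finrank_fintype_fun_eq_card, Fintype.card_fin] at h
    omega
  have hW₀le : finrank K W₀ ≤ 3 := by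
    have h2 := Submodule.finrank_mono hle
    omega
  -- (5) rank–nullity for `ρ` on `W`
  have h := finrank_eq_finrank_map_add_finrank_inf_ker W ρ
  rw [← hW₀] at h
  omega

end Summit.ValiantsHypothesis.ValiantsHypothesis.Theorems.SymPencilPerFourHessianRankThreeProp

end
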